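import Mathlib.Data.Int.GCD
import Literature.NumberTheory.GaloisRepresentations.CliffordTwistOfRestriction
import Literature.NumberTheory.GaloisRepresentations.AbsGaloisOuterConj
import HarnessLib

/-!
# Along a Galois layer of prime degree `p ∤ n` the determinant pins the twist

Topic `NumberTheory/GaloisRepresentations`; namespace `Literature.NumberTheory.GaloisRepresentations`.
Theorems only: **no definition and no named fact is introduced**.

Let `M/F` be a finite Galois extension of fields of characteristic zero of PRIME degree
`p = [M : F]`, `A` an algebraically closed topological field, and `ρ, ρ₀ : Γ_F → GL_n(A)` framed
continuous Galois representations (`FramedGaloisRep F A n`) with `p ∤ n`.  Suppose that the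
restrictions `ρ|_{Γ_M}`, `ρ₀|_{Γ_M}` (along `absGaloisRestrict F M`) are conjugate, that
`ρ₀|_{Γ_M}` is irreducible, and that `det ρ = det ρ₀`.  Then `ρ` and `ρ₀` are conjugate
(`FramedGaloisRep.exists_conj_of_conj_restrictField_of_det_eq`).

Proof.  By Clifford's theorem in the form `FramedGaloisRep.exists_twist_of_conj_restrictField`
there are `P ∈ GL_n(A)` and a continuous character `χ : Γ_F → Aˣ`, trivial on `res(Γ_M)`, with
`P ρ P⁻¹ = ρ₀ ⊗ χ`.  Taking determinants (`FramedRep.det_conj`, `FramedRep.det_twist_apply`),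
`det ρ₀ = det ρ = det (P ρ P⁻¹) = χⁿ · det ρ₀`, so `χⁿ = 1`.  On the other hand `χ` is trivial on
`res(Γ_M)`, the kernel of `Γ_F → Gal(M/F)` (`absGaloisQuot_eq_one_iff`), and `Gal(M/F)` has order
`p` (`IsGalois.card_aut_eq_finrank`), so `τᵖ ∈ res(Γ_M)` and `χ(τ)ᵖ = χ(τᵖ) = 1` for every
`τ ∈ Γ_F`.  As `gcd(p, n) = 1` (`p` prime, `p ∤ n`), `χ = 1` (`pow_eq_one_iff_of_coprime`), whence
`P ρ P⁻¹ = ρ₀ ⊗ 1 = ρ₀`.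

This is the Galois-side counterpart of the uniqueness step of prime-degree cyclic DESCENT of
automorphy: the fibre of base change `BC_{M/F}` through a cuspidal `π` of `GL_n(𝔸_F)` consists of
the twists `π ⊗ η^j` by the characters `η` of `Gal(M/F) ≅ 𝔸_F^× / F^× N_{M/F}(𝔸_M^×)`
(Arthur–Clozel 1989, Ch. 3 Thm. 4.2 (b)); their central characters are `ω_π η^{nj}`, pairwise
distinct when `p ∤ n`, so the central character — under class field theory, the determinant of the
associated Galois representation — singles out ONE member of the fibre.

## Main results

* `FramedRep.det_conj` — `det (P ρ P⁻¹) = det ρ`.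
* `pow_finrank_mem_range_absGaloisRestrict` — `τ ^ [M : F] ∈ res(Γ_M)` for `τ ∈ Γ_F`, `M/F`
  finite Galois.
* `FramedGaloisRep.exists_conj_of_conj_restrictField_of_det_eq` — the theorem of the title.

## References

* A. H. Clifford, *Representations induced in an invariant subgroup*, Ann. of Math. 38 (1937),
  533–550, §§2–3. [Clifford1937]
* J. Arthur, L. Clozel, *Simple algebras, base change, and the advanced theory of the trace formula*,
  Ann. of Math. Stud. 120 (1989), Ch. 3 Thm. 4.2. [ArthurClozelAMS120]
-/

noncomputable section

namespace Literature.NumberTheory.GaloisRepresentations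

open Field

universe u v

section Det

variable {G : Type u} [Group G] [TopologicalSpace G] {A : Type v} [CommRing A] [TopologicalSpace A]
  [IsTopologicalRing A] {n : ℕ}

/-- **The determinant is a class function**: `det (P ρ P⁻¹) = det ρ` for a framed representation
`ρ : G →ₜ* GL_n(A)` over a commutative topological ring and `P ∈ GL_n(A)`. [folklore] -/
theorem FramedRep.det_conj (P : GL (Fin n) A) (ρ : FramedRep G A n) :
    FramedRep.det (FramedRep.conj P ρ) = FramedRep.det ρ := by
  refine ContinuousMonoidHom.ext fun g => ?_
  rw [FramedRep.det_apply, FramedRep.det_apply, FramedRep.conj_apply, map_mul, map_mul, map_inv,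
    mul_inv_cancel_comm]

end Det

section Galois

variable (F M : Type*) [Field F] [Field M] [Algebra F M] [IsGalois F M] [FiniteDimensional F M]

/-- For `M/F` finite Galois and `τ ∈ Γ_F`, the power `τ ^ [M : F]` lies in `res(Γ_M)`: its image in
`Gal(M/F)`, a group of order `[M : F]` (`IsGalois.card_aut_eq_finrank`), is trivial, and `res(Γ_M)`
is the kernel of `Γ_F → Gal(M/F)` (`absGaloisQuot_eq_one_iff`). [folklore] -/
theorem pow_finrank_mem_range_absGaloisRestrict (τ : absoluteGaloisGroup F) :
    τ ^ Module.finrank F M ∈ (absGaloisRestrict F M).range := by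
  rw [← absGaloisQuot_eq_one_iff, map_pow, ← IsGalois.card_aut_eq_finrank F M, pow_card_eq_one']

end Galois

section PrimeLayer

/-- **Along a Galois layer of prime degree `p ∤ n` the determinant pins the twist.**  Let `M/F` be
Galois of prime degree `p = [M : F]` with `p ∤ n`, and let `ρ ρ₀ : Γ_F → GL_n(A)` (`A` algebraically
closed) have CONJUGATE restrictions to `Γ_M`, with `ρ₀|_{Γ_M}` irreducible, and EQUAL determinants.
Then `ρ` is conjugate to `ρ₀`.  (Clifford: `P ρ P⁻¹ = ρ₀ ⊗ χ` with `χ` a character of `Gal(M/F)`,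
so `χᵖ = 1`; determinants give `χⁿ = 1`; hence `χ = 1`.)  The Galois side of the uniqueness step
in prime-degree cyclic descent, where the fibres of base change are the twists by characters of
`Gal(M/F)` and the central character separates them when `p ∤ n`; the characteristic-zero
hypotheses are those of that setting (number fields) and play no role in the proof.
[cite: ArthurClozelAMS120, Ch. 3 Thm. 4.2 (b)] -/
theorem FramedGaloisRep.exists_conj_of_conj_restrictField_of_det_eq
    {F M : Type} [Field F] [Field M] [Algebra F M] [IsGalois F M] [CharZero F] [CharZero M]
    [FiniteDimensional F M] {A : Type v} [Field A] [TopologicalSpace A] [IsTopologicalRing A]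
    [IsAlgClosed A] {n : ℕ} (hp : (Module.finrank F M).Prime) (hn : ¬ Module.finrank F M ∣ n)
    (ρ ρ₀ : FramedGaloisRep F A n) (hirr : (ρ₀.restrictField M).IsIrreducible)
    (hconj : ∃ P : GL (Fin n) A, FramedRep.conj P (ρ.restrictField M) = ρ₀.restrictField M)
    (hdet : FramedRep.det ρ = FramedRep.det ρ₀) :
    ∃ P : GL (Fin n) A, FramedRep.conj P ρ = ρ₀ := by
  obtain ⟨χ, P, hχ, hP⟩ := FramedGaloisRep.exists_twist_of_conj_restrictField ρ ρ₀ hirr hconj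
  refine ⟨P, ?_⟩
  -- `χ ^ p = 1`: `χ` kills `res(Γ_M) ∋ τ ^ p`
  have hpowp : ∀ τ : absoluteGaloisGroup F, χ τ ^ Module.finrank F M = 1 := fun τ => by
    obtain ⟨σ, hσ⟩ := pow_finrank_mem_range_absGaloisRestrict F M τ
    rw [← map_pow, ← hσ]
    exact hχ σ
  -- `χ ^ n = 1`: compare determinants of `P ρ P⁻¹ = ρ₀ ⊗ χ`
  have hpown : ∀ τ : absoluteGaloisGroup F, χ τ ^ n = 1 := fun τ => by
    have h1 : FramedRep.det (FramedRep.conj P ρ) τ = FramedRep.det ρ₀ τ := by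
      rw [FramedRep.det_conj, hdet]
    rw [hP, FramedRep.det_apply, FramedRep.det_twist_apply, FramedRep.det_apply] at h1
    exact mul_eq_right.1 h1
  -- `gcd (p, n) = 1`, so `χ = 1`
  have hχ1 : χ = 1 := ContinuousMonoidHom.ext fun τ =>
    (pow_eq_one_iff_of_coprime ((Nat.Prime.coprime_iff_not_dvd hp).2 hn)).1 ⟨hpowp τ, hpown τ⟩
  rw [hP, hχ1, FramedRep.twist_one]

end PrimeLayer

end Literature.NumberTheory.GaloisRepresentations

end
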